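import Mathlib.Analysis.Calculus.ContDiff.Deriv
import Mathlib.Analysis.Calculus.MeanValue
import Mathlib.Analysis.SpecialFunctions.Pow.Real
import Literature.MathematicalPhysics.KineticTheory.InfiniteChainSuperstableDynamics
import HarnessLib

/-!
# Calculus of even non-negative polynomial potentials

Topic `Literature/MathematicalPhysics/KineticTheory`; first proofs companion of
`InfiniteChainSuperstableDynamics.lean` (Buttà–Marchioro 2016, Thm 2.1 for the chain). The standing
hypothesis of P. Buttà, C. Marchioro, *Dynamics of infinite classical anharmonic crystals*,
J. Stat. Phys. **164** (2016) 680–692, §2, on the pinning `U` and the coupling `V` is vendored in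
that file as `OscillatorChain.IsEvenPolyOfDegree f s`:
`f(x) = ∑_{m ≤ s} a_m x^{2m}`, `a_s > 0`, `f ≥ 0`. This file collects the elementary calculus
facts about such `f` that the proof of Thm 2.1 (§3 of the paper) uses without comment:

* `IsEvenPolyOfDegree.contDiff`, `.differentiable`, `.bddBelow_range`, the derivative formulas
  (`exists_coeff_deriv_bounds`; continuity itself is `IsEvenPolyOfDegree.continuous` upstream);
* growth of the derivatives: `|f'(x)| ≤ C (1 + |x|^{2s-1})`, `|f''(x)| ≤ C (1 + |x|^{2s-2})`
  ("in view of the assumptions on the polynomials `U` and `V`", §3 after (3.4));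
* coercivity `c |x|^{2s} ≤ f(x) + C` (positive leading coefficient), and the resulting MOMENT
  BOUNDS `|x|^{2s-2} ≤ C (E+1)^θ` for `f(x) ≤ E`, `θ ≥ (s-1)/s` (the step
  `|q|^{2σ₁-2} ≤ C W^{(σ₁-1)/σ₁} ≤ C W^η` of §3), `|x| ≤ C (E+1)^{1/2}`, `|x|^{2s-1}, |x|^{2s} ≤ C (E+1)`;
* the mean-value estimates `|f'(x) - f'(y)| ≤ C (1 + |x|^{2s-2} + |y|^{2s-2}) |x - y|` (the bound on
  `T^{μ,n}_i`, `T^{μ,n}_{i,j}` in §3) and `|f(x) - f(y)| ≤ C (f(y) + 1) |x - y|` for `|x - y| ≤ 1`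
  (the "Lipschitz constant of the energy … computed in points close to" the partial dynamics,
  §3 before (2.7)).

Everything here is proved; no new definitions, no named facts.

## References

* P. Buttà, C. Marchioro, *Dynamics of infinite classical anharmonic crystals*, J. Stat. Phys.
  164 (2016) 680–692, doi:10.1007/s10955-016-1540-x, arXiv:1602.01294, §2–§3. [ButtaMarchioro2016]
-/

noncomputable section

open Set

namespace Literature.MathematicalPhysics.KineticTheory.HeatConduction

namespace OscillatorChain

/-! ### Two elementary inequalities on powers of `|x|` -/

/-- `|x|^j ≤ 1 + |x|^k` for `j ≤ k` (split according to `|x| ≤ 1`). [folklore] -/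
theorem abs_pow_le_one_add_abs_pow (x : ℝ) {j k : ℕ} (h : j ≤ k) : |x| ^ j ≤ 1 + |x| ^ k := by
  rcases le_or_gt |x| 1 with hx | hx
  · have h1 : |x| ^ j ≤ 1 := pow_le_one₀ (abs_nonneg x) hx
    have h2 : 0 ≤ |x| ^ k := pow_nonneg (abs_nonneg x) k
    linarith
  · have h1 : |x| ^ j ≤ |x| ^ k := pow_le_pow_right₀ hx.le h
    linarith

/-- On the segment `[[x, y]]` every power of `|z|` is at most `|x|^k + |y|^k`. [folklore] -/
theorem abs_pow_le_add_of_mem_uIcc {x y z : ℝ} (hz : z ∈ uIcc x y) (k : ℕ) :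
    |z| ^ k ≤ |x| ^ k + |y| ^ k := by
  have hz' : |z| ≤ max |x| |y| := by
    rcases mem_uIcc.1 hz with ⟨h1, h2⟩ | ⟨h1, h2⟩
    · exact abs_le_max_abs_abs h1 h2
    · rw [max_comm]; exact abs_le_max_abs_abs h1 h2
  have hk : |z| ^ k ≤ (max |x| |y|) ^ k := pow_le_pow_left₀ (abs_nonneg z) hz' k
  rcases le_total |x| |y| with hxy | hxy
  · rw [max_eq_right hxy] at hk
    linarith [pow_nonneg (abs_nonneg x) k]
  · rw [max_eq_left hxy] at hk
    linarith [pow_nonneg (abs_nonneg y) k]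

namespace IsEvenPolyOfDegree

variable {f : ℝ → ℝ} {s : ℕ}

/-! ### The polynomial, its derivatives, smoothness -/

/-- An `IsEvenPolyOfDegree` potential is non-negative. [cite: ButtaMarchioro2016, §2 (hypotheses on U, V)] -/
theorem nonneg (hf : IsEvenPolyOfDegree f s) (x : ℝ) : 0 ≤ f x :=
  hf.choose_spec.2.2 x

/-- An `IsEvenPolyOfDegree` potential is an even function: `f(-x) = f(x)`. [folklore] -/
theorem neg_apply (hf : IsEvenPolyOfDegree f s) (x : ℝ) : f (-x) = f x := by
  obtain ⟨a, -, hfx, -⟩ := hf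
  rw [hfx, hfx]
  refine Finset.sum_congr rfl fun m _ => ?_
  rw [pow_mul, pow_mul, neg_sq]

/-- An `IsEvenPolyOfDegree` potential is bounded below (by `0`). [folklore] -/
theorem bddBelow_range (hf : IsEvenPolyOfDegree f s) : BddBelow (range f) :=
  ⟨0, by rintro _ ⟨x, rfl⟩; exact hf.nonneg x⟩

/-- The first derivative of `x ↦ ∑_{m ≤ s} a_m x^{2m}`. [folklore] -/
theorem hasDerivAt_sum (a : ℕ → ℝ) (s : ℕ) (x : ℝ) :
    HasDerivAt (fun y => ∑ m ∈ Finset.range (s + 1), a m * y ^ (2 * m))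
      (∑ m ∈ Finset.range (s + 1), a m * (((2 * m : ℕ) : ℝ) * x ^ (2 * m - 1))) x := by
  apply HasDerivAt.fun_sum
  intro m _
  exact (hasDerivAt_pow (2 * m) x).const_mul (a m)

/-- The second derivative of `x ↦ ∑_{m ≤ s} a_m x^{2m}`. [folklore] -/
theorem hasDerivAt_sum_deriv (a : ℕ → ℝ) (s : ℕ) (x : ℝ) :
    HasDerivAt (fun y => ∑ m ∈ Finset.range (s + 1), a m * (((2 * m : ℕ) : ℝ) * y ^ (2 * m - 1)))
      (∑ m ∈ Finset.range (s + 1),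
        a m * (((2 * m : ℕ) : ℝ) * ((((2 * m - 1 : ℕ) : ℕ) : ℝ) * x ^ (2 * m - 2)))) x := by
  apply HasDerivAt.fun_sum
  intro m _
  have h := ((hasDerivAt_pow (2 * m - 1) x).const_mul (((2 * m : ℕ) : ℝ))).const_mul (a m)
  have e : 2 * m - 1 - 1 = 2 * m - 2 := by omega
  rw [e] at h
  exact h

/-- The coefficient representation, with the function rewritten as the polynomial sum. [folklore] -/
theorem eq_sum (hf : IsEvenPolyOfDegree f s) :
    ∃ a : ℕ → ℝ, 0 < a s ∧ f = fun x => ∑ m ∈ Finset.range (s + 1), a m * x ^ (2 * m) := by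
  obtain ⟨a, ha, hfx, -⟩ := hf
  exact ⟨a, ha, funext hfx⟩

/-- Even polynomial potentials are smooth. [folklore] -/
theorem contDiff (hf : IsEvenPolyOfDegree f s) {n : WithTop ℕ∞} : ContDiff ℝ n f := by
  obtain ⟨a, -, rfl⟩ := hf.eq_sum
  apply ContDiff.sum
  intro m _
  exact contDiff_const.mul (contDiff_id.pow _)

/-- Even polynomial potentials are differentiable. [folklore] -/
theorem differentiable (hf : IsEvenPolyOfDegree f s) : Differentiable ℝ f :=
  (hf.contDiff (n := 1)).differentiable one_ne_zero

/-- The derivative of an even polynomial potential is continuous. [folklore] -/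
theorem continuous_deriv (hf : IsEvenPolyOfDegree f s) : Continuous (deriv f) :=
  (hf.contDiff (n := 1)).continuous_deriv_one

/-- The derivative of an even polynomial potential is differentiable. [folklore] -/
theorem differentiable_deriv (hf : IsEvenPolyOfDegree f s) : Differentiable ℝ (deriv f) :=
  (hf.contDiff (n := 2)).differentiable_deriv_two

/-- **Derivative formulas and growth bounds.** There are coefficients `a` (with `a_s > 0`) and a
constant `C ≥ 0` such that `f`, `f'`, `f''` are the expected polynomial sums and
`|f'(x)| ≤ C (1 + |x|^{2s-1})`, `|f''(x)| ≤ C (1 + |x|^{2s-2})` for all `x`.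
[cite: ButtaMarchioro2016, §3 (bounds on T^{μ,n}_i, T^{μ,n}_{i,j})] -/
theorem exists_coeff_deriv_bounds (hf : IsEvenPolyOfDegree f s) :
    ∃ (a : ℕ → ℝ) (C : ℝ), 0 < a s ∧ 0 ≤ C ∧
      (∀ x, f x = ∑ m ∈ Finset.range (s + 1), a m * x ^ (2 * m)) ∧
      (∀ x, deriv f x = ∑ m ∈ Finset.range (s + 1), a m * (((2 * m : ℕ) : ℝ) * x ^ (2 * m - 1))) ∧
      (∀ x, deriv (deriv f) x = ∑ m ∈ Finset.range (s + 1),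
        a m * (((2 * m : ℕ) : ℝ) * ((((2 * m - 1 : ℕ) : ℕ) : ℝ) * x ^ (2 * m - 2)))) ∧
      (∀ x, |deriv f x| ≤ C * (1 + |x| ^ (2 * s - 1))) ∧
      ∀ x, |deriv (deriv f) x| ≤ C * (1 + |x| ^ (2 * s - 2)) := by
  obtain ⟨a, ha, hfeq⟩ := hf.eq_sum
  have hd1 : ∀ x, deriv f x =
      ∑ m ∈ Finset.range (s + 1), a m * (((2 * m : ℕ) : ℝ) * x ^ (2 * m - 1)) := fun x => by
    rw [hfeq]; exact (hasDerivAt_sum a s x).deriv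
  have hd1' : deriv f =
      fun x => ∑ m ∈ Finset.range (s + 1), a m * (((2 * m : ℕ) : ℝ) * x ^ (2 * m - 1)) :=
    funext hd1
  have hd2 : ∀ x, deriv (deriv f) x = ∑ m ∈ Finset.range (s + 1),
      a m * (((2 * m : ℕ) : ℝ) * ((((2 * m - 1 : ℕ) : ℕ) : ℝ) * x ^ (2 * m - 2))) := fun x => by
    rw [hd1']; exact (hasDerivAt_sum_deriv a s x).deriv
  set C : ℝ := ∑ m ∈ Finset.range (s + 1), |a m| * ((2 * m : ℕ) : ℝ) * (((2 * m - 1 : ℕ) : ℝ) + 1)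
    with hC
  have hC0 : 0 ≤ C := Finset.sum_nonneg fun m _ => by positivity
  refine ⟨a, C, ha, hC0, fun x => by rw [hfeq], hd1, hd2, fun x => ?_, fun x => ?_⟩
  · rw [hd1 x]
    refine (Finset.abs_sum_le_sum_abs _ _).trans ?_
    rw [hC, Finset.sum_mul]
    refine Finset.sum_le_sum fun m hm => ?_
    have hms : m ≤ s := Nat.lt_succ_iff.mp (Finset.mem_range.mp hm)
    rw [abs_mul, abs_mul, abs_pow, Nat.abs_cast]
    have h1 : |x| ^ (2 * m - 1) ≤ 1 + |x| ^ (2 * s - 1) :=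
      abs_pow_le_one_add_abs_pow x (by omega)
    have h2 : (0 : ℝ) ≤ ((2 * m - 1 : ℕ) : ℝ) := by positivity
    have h3 : (0 : ℝ) ≤ |a m| * ((2 * m : ℕ) : ℝ) := by positivity
    calc |a m| * (((2 * m : ℕ) : ℝ) * |x| ^ (2 * m - 1))
        = |a m| * ((2 * m : ℕ) : ℝ) * 1 * |x| ^ (2 * m - 1) := by ring
      _ ≤ |a m| * ((2 * m : ℕ) : ℝ) * (((2 * m - 1 : ℕ) : ℝ) + 1) * (1 + |x| ^ (2 * s - 1)) := by
          apply mul_le_mul _ h1 (by positivity) (by positivity)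
          exact mul_le_mul_of_nonneg_left (by linarith) h3
  · rw [hd2 x]
    refine (Finset.abs_sum_le_sum_abs _ _).trans ?_
    rw [hC, Finset.sum_mul]
    refine Finset.sum_le_sum fun m hm => ?_
    have hms : m ≤ s := Nat.lt_succ_iff.mp (Finset.mem_range.mp hm)
    rw [abs_mul, abs_mul, abs_mul, abs_pow, Nat.abs_cast, Nat.abs_cast]
    have h1 : |x| ^ (2 * m - 2) ≤ 1 + |x| ^ (2 * s - 2) :=
      abs_pow_le_one_add_abs_pow x (by omega)
    have h2 : (0 : ℝ) ≤ ((2 * m - 1 : ℕ) : ℝ) := by positivity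
    have h3 : (0 : ℝ) ≤ |a m| * ((2 * m : ℕ) : ℝ) := by positivity
    calc |a m| * (((2 * m : ℕ) : ℝ) * (((2 * m - 1 : ℕ) : ℝ) * |x| ^ (2 * m - 2)))
        = |a m| * ((2 * m : ℕ) : ℝ) * ((2 * m - 1 : ℕ) : ℝ) * |x| ^ (2 * m - 2) := by ring
      _ ≤ |a m| * ((2 * m : ℕ) : ℝ) * (((2 * m - 1 : ℕ) : ℝ) + 1) * (1 + |x| ^ (2 * s - 2)) := by
          apply mul_le_mul _ h1 (by positivity) (by positivity)
          exact mul_le_mul_of_nonneg_left (by linarith) h3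

/-- Growth of the first derivative: `|f'(x)| ≤ C (1 + |x|^{2s-1})`. [folklore] -/
theorem exists_abs_deriv_le (hf : IsEvenPolyOfDegree f s) :
    ∃ C : ℝ, 0 ≤ C ∧ ∀ x, |deriv f x| ≤ C * (1 + |x| ^ (2 * s - 1)) := by
  obtain ⟨_, C, -, hC, -, -, -, h1, -⟩ := hf.exists_coeff_deriv_bounds
  exact ⟨C, hC, h1⟩

/-- Growth of the second derivative: `|f''(x)| ≤ C (1 + |x|^{2s-2})` ("in view of the assumptions
on the polynomials", BM §3). [cite: ButtaMarchioro2016, §3 (bounds on T^{μ,n}_i, T^{μ,n}_{i,j})] -/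
theorem exists_abs_deriv_deriv_le (hf : IsEvenPolyOfDegree f s) :
    ∃ C : ℝ, 0 ≤ C ∧ ∀ x, |deriv (deriv f) x| ≤ C * (1 + |x| ^ (2 * s - 2)) := by
  obtain ⟨_, C, -, hC, -, -, -, -, h2⟩ := hf.exists_coeff_deriv_bounds
  exact ⟨C, hC, h2⟩

/-! ### Mean value estimates -/

/-- **Lipschitz estimate for `f'`** (the bound `|G(ξ') - G(ξ)| ≤ |ξ' - ξ| ∫₀¹ ‖DG(ξ_λ)‖ dλ` of
BM §3 with `G = U'` and the growth of `U''`):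
`|f'(x) - f'(y)| ≤ C (1 + |x|^{2s-2} + |y|^{2s-2}) |x - y|`. [cite: ButtaMarchioro2016, §3 eq. (3.4) and the bounds following it] -/
theorem exists_abs_deriv_sub_deriv_le (hf : IsEvenPolyOfDegree f s) :
    ∃ C : ℝ, 0 ≤ C ∧ ∀ x y,
      |deriv f x - deriv f y| ≤ C * (1 + |x| ^ (2 * s - 2) + |y| ^ (2 * s - 2)) * |x - y| := by
  obtain ⟨C, hC, h2⟩ := hf.exists_abs_deriv_deriv_le
  have hdiff : Differentiable ℝ (deriv f) := hf.differentiable_deriv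
  refine ⟨C, hC, fun x y => ?_⟩
  have key := Convex.norm_image_sub_le_of_norm_deriv_le (f := deriv f) (s := uIcc y x)
    (C := C * (1 + |x| ^ (2 * s - 2) + |y| ^ (2 * s - 2))) (fun z _ => hdiff z) ?_
    (convex_uIcc y x) left_mem_uIcc right_mem_uIcc
  · simpa [Real.norm_eq_abs] using key
  · intro z hz
    rw [Real.norm_eq_abs]
    refine (h2 z).trans ?_
    have hz' : |z| ^ (2 * s - 2) ≤ |y| ^ (2 * s - 2) + |x| ^ (2 * s - 2) :=
      abs_pow_le_add_of_mem_uIcc hz _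
    have : 1 + |z| ^ (2 * s - 2) ≤ 1 + |x| ^ (2 * s - 2) + |y| ^ (2 * s - 2) := by linarith
    exact mul_le_mul_of_nonneg_left this hC

/-- **Lipschitz estimate for `f`**: `|f(x) - f(y)| ≤ C (1 + |x|^{2s-1} + |y|^{2s-1}) |x - y|`.
[folklore] -/
theorem exists_abs_sub_le (hf : IsEvenPolyOfDegree f s) :
    ∃ C : ℝ, 0 ≤ C ∧ ∀ x y,
      |f x - f y| ≤ C * (1 + |x| ^ (2 * s - 1) + |y| ^ (2 * s - 1)) * |x - y| := by
  obtain ⟨C, hC, h1⟩ := hf.exists_abs_deriv_le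
  have hdiff := hf.differentiable
  refine ⟨C, hC, fun x y => ?_⟩
  have key := Convex.norm_image_sub_le_of_norm_deriv_le (f := f) (s := uIcc y x)
    (C := C * (1 + |x| ^ (2 * s - 1) + |y| ^ (2 * s - 1))) (fun z _ => hdiff z) ?_
    (convex_uIcc y x) left_mem_uIcc right_mem_uIcc
  · simpa [Real.norm_eq_abs] using key
  · intro z hz
    rw [Real.norm_eq_abs]
    refine (h1 z).trans ?_
    have hz' : |z| ^ (2 * s - 1) ≤ |y| ^ (2 * s - 1) + |x| ^ (2 * s - 1) :=
      abs_pow_le_add_of_mem_uIcc hz _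
    have : 1 + |z| ^ (2 * s - 1) ≤ 1 + |x| ^ (2 * s - 1) + |y| ^ (2 * s - 1) := by linarith
    exact mul_le_mul_of_nonneg_left this hC

/-! ### Coercivity and moment bounds -/

/-- **Coercivity** of an even polynomial with positive leading coefficient:
`c |x|^{2s} ≤ f(x) + C` for some `c > 0`, `C ≥ 0`. [folklore] -/
theorem exists_coercive (hf : IsEvenPolyOfDegree f s) :
    ∃ c C : ℝ, 0 < c ∧ 0 ≤ C ∧ ∀ x, c * |x| ^ (2 * s) ≤ f x + C := by
  obtain ⟨a, ha, hfeq⟩ := hf.eq_sum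
  have hnn := hf.nonneg
  -- the lower-order coefficients
  set S : ℝ := ∑ m ∈ Finset.range s, |a m| with hS
  have hS0 : 0 ≤ S := Finset.sum_nonneg fun m _ => abs_nonneg _
  set R : ℝ := 1 + 2 * S / a s with hR
  have hR1 : 1 ≤ R := by
    have : 0 ≤ 2 * S / a s := by positivity
    rw [hR]; linarith
  have hR0 : 0 < R := lt_of_lt_of_le one_pos hR1
  have hRS : 2 * S ≤ a s * R ^ 2 := by
    have h1 : 2 * S / a s ≤ R := by rw [hR]; linarith
    have h2 : 2 * S ≤ a s * R := by
      have := (div_le_iff₀ ha).mp h1; linarith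
    have h3 : a s * R ≤ a s * R ^ 2 := by
      rw [sq]; exact mul_le_mul_of_nonneg_left (le_mul_of_one_le_left hR0.le hR1) ha.le
    linarith
  refine ⟨a s / 2, a s / 2 * R ^ (2 * s), by positivity, by positivity, fun x => ?_⟩
  rcases le_or_gt |x| R with hx | hx
  · -- small `x`: the constant absorbs everything
    have h1 : |x| ^ (2 * s) ≤ R ^ (2 * s) := pow_le_pow_left₀ (abs_nonneg x) hx _
    have h2 : a s / 2 * |x| ^ (2 * s) ≤ a s / 2 * R ^ (2 * s) :=
      mul_le_mul_of_nonneg_left h1 (by positivity)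
    linarith [hnn x]
  · -- large `x`: the top monomial dominates
    have hx1 : 1 ≤ |x| := hR1.trans hx.le
    have hlow : ∀ m ∈ Finset.range s, |a m * x ^ (2 * m)| ≤ |a m| * |x| ^ (2 * s) / R ^ 2 := by
      intro m hm
      have hms : m < s := Finset.mem_range.mp hm
      rw [abs_mul, abs_pow, le_div_iff₀ (by positivity)]
      have h1 : R ^ 2 ≤ |x| ^ 2 := pow_le_pow_left₀ hR0.le hx.le 2
      have h2 : |x| ^ 2 ≤ |x| ^ (2 * (s - m)) := pow_le_pow_right₀ hx1 (by omega)
      have h3 : |x| ^ (2 * m) * |x| ^ (2 * (s - m)) = |x| ^ (2 * s) := by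
        rw [← pow_add]; congr 1; omega
      calc |a m| * |x| ^ (2 * m) * R ^ 2 ≤ |a m| * |x| ^ (2 * m) * |x| ^ (2 * (s - m)) := by
            apply mul_le_mul_of_nonneg_left (h1.trans h2) (by positivity)
        _ = |a m| * |x| ^ (2 * s) := by rw [mul_assoc, h3]
    have hsum : |∑ m ∈ Finset.range s, a m * x ^ (2 * m)| ≤ S * |x| ^ (2 * s) / R ^ 2 := by
      refine (Finset.abs_sum_le_sum_abs _ _).trans ?_
      rw [hS, Finset.sum_mul, Finset.sum_div]
      exact Finset.sum_le_sum hlow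
    have hsum' : S * |x| ^ (2 * s) / R ^ 2 ≤ a s / 2 * |x| ^ (2 * s) := by
      rw [div_le_iff₀ (by positivity)]
      have : 0 ≤ |x| ^ (2 * s) := by positivity
      nlinarith
    have htop : a s * x ^ (2 * s) = a s * |x| ^ (2 * s) := by
      rw [← abs_pow, abs_of_nonneg (Even.pow_nonneg ⟨s, two_mul s⟩ x)]
    have hfx : f x = (∑ m ∈ Finset.range s, a m * x ^ (2 * m)) + a s * x ^ (2 * s) := by
      rw [hfeq]; exact Finset.sum_range_succ _ _
    have hneg := neg_abs_le (∑ m ∈ Finset.range s, a m * x ^ (2 * m))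
    have hC0 : 0 ≤ a s / 2 * R ^ (2 * s) := by positivity
    rw [hfx, htop]
    linarith

/-- Power bookkeeping: `(|x|^{2s})^{θ} = |x|^{2sθ}` as real powers, for the exponents used below.
[folklore] -/
theorem abs_pow_two_mul_rpow (x : ℝ) (s : ℕ) (θ : ℝ) :
    (|x| ^ (2 * s) : ℝ) ^ θ = |x| ^ ((2 * s : ℝ) * θ) := by
  rw [Real.rpow_mul (abs_nonneg x), ← Real.rpow_natCast]
  norm_cast

/-- **Moment bound for `|x|^{2s-2}`** ("`|q|^{2σ₁-2} ≤ C W^{(σ₁-1)/σ₁} ≤ C W^η`", BM §3): if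
`f(x) ≤ E` with `E ≥ 0` then `|x|^{2s-2} ≤ C (E+1)^θ` for every `θ ≥ (s-1)/s` (here `s ≥ 1`).
[cite: ButtaMarchioro2016, §3 (bounds on T^{μ,n}_i, T^{μ,n}_{i,j})] -/
theorem exists_pow_le_rpow (hf : IsEvenPolyOfDegree f s) (hs : 1 ≤ s) :
    ∃ C : ℝ, 1 ≤ C ∧ ∀ (θ : ℝ), ((s : ℝ) - 1) / s ≤ θ → ∀ (E : ℝ), 0 ≤ E → ∀ x, f x ≤ E →
      |x| ^ (2 * s - 2) ≤ C * (E + 1) ^ θ := by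
  obtain ⟨c, C₀, hc, hC₀, hco⟩ := hf.exists_coercive
  -- `|x|^{2s} ≤ C₁ (E + 1)`
  set C₁ : ℝ := max 1 C₀ / c with hC₁
  have hC₁1 : 0 < C₁ := by positivity
  have hs0 : (0 : ℝ) < s := by exact_mod_cast hs
  set θ₀ : ℝ := ((s : ℝ) - 1) / s with hθ₀
  have hθ₀0 : 0 ≤ θ₀ := div_nonneg (by linarith [show (1 : ℝ) ≤ s by exact_mod_cast hs]) hs0.le
  have hθ₀1 : θ₀ ≤ 1 := by rw [hθ₀, div_le_one hs0]; linarith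
  refine ⟨max 1 (C₁ ^ θ₀), le_max_left _ _, fun θ hθ E hE x hx => ?_⟩
  have h1 : |x| ^ (2 * s) ≤ C₁ * (E + 1) := by
    have h2 : c * |x| ^ (2 * s) ≤ E + C₀ := (hco x).trans (by linarith)
    have h3 : E + C₀ ≤ max 1 C₀ * (E + 1) := by
      have := le_max_right 1 C₀
      have := le_max_left 1 C₀
      nlinarith
    rw [hC₁, div_mul_eq_mul_div, le_div_iff₀ hc]
    linarith
  -- take the `θ₀`-th power
  have h4 : (|x| ^ (2 * s) : ℝ) ^ θ₀ ≤ (C₁ * (E + 1)) ^ θ₀ :=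
    Real.rpow_le_rpow (by positivity) h1 hθ₀0
  have h5 : (|x| ^ (2 * s) : ℝ) ^ θ₀ = |x| ^ (2 * s - 2) := by
    rw [abs_pow_two_mul_rpow]
    have : (2 * s : ℝ) * θ₀ = ((2 * s - 2 : ℕ) : ℝ) := by
      rw [hθ₀]
      field_simp
      push_cast [show 2 ≤ 2 * s by omega]
      ring
    rw [this, Real.rpow_natCast]
  have h6 : (C₁ * (E + 1)) ^ θ₀ = C₁ ^ θ₀ * (E + 1) ^ θ₀ :=
    Real.mul_rpow hC₁1.le (by positivity)
  have h7 : (E + 1) ^ θ₀ ≤ (E + 1) ^ θ :=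
    Real.rpow_le_rpow_of_exponent_le (by linarith) hθ
  have h8 : C₁ ^ θ₀ ≤ max 1 (C₁ ^ θ₀) := le_max_right _ _
  have h9 : 0 ≤ C₁ ^ θ₀ := by positivity
  have h10 : 0 ≤ (E + 1) ^ θ₀ := by positivity
  calc |x| ^ (2 * s - 2) = (|x| ^ (2 * s) : ℝ) ^ θ₀ := h5.symm
    _ ≤ C₁ ^ θ₀ * (E + 1) ^ θ₀ := h4.trans_eq h6
    _ ≤ max 1 (C₁ ^ θ₀) * (E + 1) ^ θ := by gcongr

/-- **Moment bounds of order `≤ 2s`**: if `f(x) ≤ E` with `E ≥ 0` then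
`|x|^{2s} ≤ C (E+1)`, `|x|^{2s-1} ≤ C (E+1)`, and `|x| ≤ C (E+1)^{1/2}` (via `|x|² ≤ C (E + 1)`).
[folklore] -/
theorem exists_moment_bounds (hf : IsEvenPolyOfDegree f s) (hs : 1 ≤ s) :
    ∃ C : ℝ, 1 ≤ C ∧ ∀ (E : ℝ), 0 ≤ E → ∀ x, f x ≤ E →
      |x| ^ (2 * s) ≤ C * (E + 1) ∧ |x| ^ (2 * s - 1) ≤ C * (E + 1) ∧
        |x| ≤ C * Real.sqrt (E + 1) := by
  obtain ⟨c, C₀, hc, hC₀, hco⟩ := hf.exists_coercive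
  set C₁ : ℝ := max 1 C₀ / c with hC₁
  have hC₁0 : 0 < C₁ := by positivity
  refine ⟨max 1 (C₁ + 1), le_max_left _ _, fun E hE x hx => ?_⟩
  have h1 : |x| ^ (2 * s) ≤ C₁ * (E + 1) := by
    have h2 : c * |x| ^ (2 * s) ≤ E + C₀ := (hco x).trans (by linarith)
    have h3 : E + C₀ ≤ max 1 C₀ * (E + 1) := by
      have := le_max_right 1 C₀
      have := le_max_left 1 C₀
      nlinarith
    rw [hC₁, div_mul_eq_mul_div, le_div_iff₀ hc]
    linarith
  have hmax : C₁ + 1 ≤ max 1 (C₁ + 1) := le_max_right _ _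
  have hE1 : 1 ≤ E + 1 := by linarith
  refine ⟨h1.trans (by nlinarith), ?_, ?_⟩
  · have h2 : |x| ^ (2 * s - 1) ≤ 1 + |x| ^ (2 * s) := abs_pow_le_one_add_abs_pow x (by omega)
    nlinarith
  · -- `|x|^2 ≤ 1 + |x|^{2s} ≤ (C₁ + 1)(E + 1)`, then take square roots
    have h2 : |x| ^ 2 ≤ 1 + |x| ^ (2 * s) := abs_pow_le_one_add_abs_pow x (by omega)
    have h3 : |x| ^ 2 ≤ (C₁ + 1) * (E + 1) := by nlinarith
    have h4 : |x| ≤ Real.sqrt ((C₁ + 1) * (E + 1)) := Real.abs_le_sqrt (by simpa [sq_abs] using h3)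
    have h5 : Real.sqrt ((C₁ + 1) * (E + 1)) = Real.sqrt (C₁ + 1) * Real.sqrt (E + 1) :=
      Real.sqrt_mul (by positivity) _
    have h6 : Real.sqrt (C₁ + 1) ≤ C₁ + 1 := by
      rw [Real.sqrt_le_left (by positivity)]
      nlinarith
    calc |x| ≤ Real.sqrt (C₁ + 1) * Real.sqrt (E + 1) := h4.trans_eq h5
      _ ≤ max 1 (C₁ + 1) * Real.sqrt (E + 1) := by gcongr; exact h6.trans hmax

/-- **Local Lipschitz bound of the energy density** (the "Lipschitz constant of the energy …
computed in points close to" the approximating dynamics, BM §3 before (2.7)):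
`|f(x) - f(y)| ≤ C (f(y) + 1) |x - y|` whenever `|x - y| ≤ 1`. [cite: ButtaMarchioro2016, §3 (proof of (2.7))] -/
theorem exists_abs_sub_le_of_near (hf : IsEvenPolyOfDegree f s) (hs : 1 ≤ s) :
    ∃ C : ℝ, 0 ≤ C ∧ ∀ x y, |x - y| ≤ 1 → |f x - f y| ≤ C * (f y + 1) * |x - y| := by
  obtain ⟨C, hC, hL⟩ := hf.exists_abs_sub_le
  obtain ⟨C', hC', hM⟩ := hf.exists_moment_bounds hs
  have hnn := hf.nonneg
  -- `|x|^{2s-1} ≤ 2^{2s-1} (|y|^{2s-1} + 1)` when `|x - y| ≤ 1`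
  refine ⟨C * (1 + (2 ^ (2 * s - 1) + 1) * C' + 2 ^ (2 * s - 1)), by positivity,
    fun x y hxy => ?_⟩
  obtain ⟨-, hy, -⟩ := hM (f y) (hnn y) y le_rfl
  have hx1 : |x| ≤ |y| + 1 := by
    have := abs_sub_abs_le_abs_sub x y
    linarith
  have hx2 : |x| ^ (2 * s - 1) ≤ (|y| + 1) ^ (2 * s - 1) := pow_le_pow_left₀ (abs_nonneg x) hx1 _
  have hx3 : (|y| + 1) ^ (2 * s - 1) ≤ 2 ^ (2 * s - 1 - 1) * (|y| ^ (2 * s - 1) + 1 ^ (2 * s - 1)) :=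
    add_pow_le (abs_nonneg y) zero_le_one _
  have hx4 : (2 : ℝ) ^ (2 * s - 1 - 1) ≤ 2 ^ (2 * s - 1) := pow_le_pow_right₀ (by norm_num) (by omega)
  have hy0 : 0 ≤ |y| ^ (2 * s - 1) := by positivity
  have hx5 : |x| ^ (2 * s - 1) ≤ 2 ^ (2 * s - 1) * (|y| ^ (2 * s - 1) + 1) := by
    rw [one_pow] at hx3
    exact hx2.trans (hx3.trans (mul_le_mul_of_nonneg_right hx4 (by positivity)))
  have key : 1 + |x| ^ (2 * s - 1) + |y| ^ (2 * s - 1) ≤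
      (1 + (2 ^ (2 * s - 1) + 1) * C' + 2 ^ (2 * s - 1)) * (f y + 1) := by
    have hfy : 0 ≤ f y := hnn y
    have h2s : (0 : ℝ) ≤ 2 ^ (2 * s - 1) := by positivity
    nlinarith
  calc |f x - f y| ≤ C * (1 + |x| ^ (2 * s - 1) + |y| ^ (2 * s - 1)) * |x - y| := hL x y
    _ ≤ C * ((1 + (2 ^ (2 * s - 1) + 1) * C' + 2 ^ (2 * s - 1)) * (f y + 1)) * |x - y| := by
        gcongr
    _ = C * (1 + (2 ^ (2 * s - 1) + 1) * C' + 2 ^ (2 * s - 1)) * (f y + 1) * |x - y| := by ring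

end IsEvenPolyOfDegree

end OscillatorChain

end Literature.MathematicalPhysics.KineticTheory.HeatConduction
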